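import Literature.AlgebraicGeometry.Motives.ZarhinHodgeGroupDerivationLie
import Literature.AlgebraicGeometry.Motives.ZarhinHodgeGroupTypePP
import Literature.AlgebraicGeometry.Motives.ZarhinHodgeGroupDescent
import Literature.AlgebraicGeometry.Motives.HodgeTensorHodgeGroupPolarizationProofs
import HarnessLib

/-!
# The Lie algebra of the Hodge group: definition over `ℚ`, complexification, `Θ`, `Ad(C)`, skewness and commutant (Zarhin's theorem, step 4)

For a pure `ℚ`-Hodge structure `H` of weight `n` on a finite-dimensional `V`, the tree's Hodge
group `H.hodgeGroup ≤ GL(V)(ℚ)` (`Motives/HodgeTensor`) is the group of rational points of the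
stabiliser of all Hodge tensors of all types `(p,p)` in all `T^{a,b} V` (`(a - b) n = 2p`). This
file DEFINES its Lie algebra and records the structure used in the tree's proof of Zarhin's
theorem (Huybrechts, *Lectures on K3 Surfaces*, Thm. 3.3.9; Zarhin 1983, §2):

* `hodgeLie H ⊆ End_ℚ(V)` (**definition**): the `X` whose derivation action `ρ(X)` kills every
  Hodge tensor of type `(p,p)` — the Lie algebra of the stabiliser `ℚ`-group scheme whose
  rational points are `H.hodgeGroup` (Borel, *Linear Algebraic Groups*, §3.8–3.9: the Lie algebra
  of a stabiliser is the annihilator); `hodgeLieC H ⊆ End_ℂ(V_ℂ)` (**definition**): its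
  complexification, the `ℂ`-span of the `X_ℂ`, `X ∈ hodgeLie H`. Indexing structure
  `HodgeTensorIdxPP` (**definition**, the analogue of `HodgeTensorIdx` for all types `(p,p)`).
* `mem_hodgeLieC_iff`: `hodgeLieC H` IS the complex annihilator of the complexified Hodge tensors
  ("`Hdg` is defined over `ℚ`": descent statement of `ZarhinHodgeGroupDescent`).
* Both are Lie subalgebras (`commutator_mem_hodgeLie`, `commutator_mem_hodgeLieC`); the
  infinitesimal Hodge operator `Θ` (`p - q` on `V^{p,q}`) lies in `hodgeLieC`
  (`mem_hodgeLieC_of_forall_piece`, infinitesimal form of `h(U(1)) ⊆ Hdg(ℝ)`); `hodgeLieC` is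
  stable under `Ad` of any automorphism fixing the complexified Hodge tensors, e.g. the Weil
  operator `C` (`conj_mem_hodgeLieC_of_forall_piece`).
* With a polarization `ψ`: `hodgeLie ⊆ so(ψ)` (`form_apply_add_eq_zero_of_mem_hodgeLie`, since
  `ψ ∈ T^{0,2}` is a Hodge tensor, `sum_sum_smul_tprod_tmul_tprod_mem_hodgeClasses`), and its
  complex form; `hodgeLie` commutes with `End_Hdg(V)` (`commute_of_mem_hodgeLie`, since
  `End_Hdg ⊆ T^{1,1}` consists of Hodge tensors, `sum_tprod_tmul_tprod_coord_mem_hodgeClasses`).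
* COMMUTANT: a rational endomorphism commuting with `hodgeLie H` is a Hodge endomorphism
  (`mem_endAlg_of_forall_commute`, because `Θ ∈ hodgeLieC` and the Hodge pieces are the
  eigenspaces of `Θ`), hence a `ℂ`-linear endomorphism of `V_ℂ` commuting with `hodgeLieC` lies in
  `span_ℂ {a_ℂ | a ∈ End_Hdg(V)}` (`mem_span_endAlg_of_forall_commute`, commutant descent). This
  is the tree's replacement for "`End_{Hdg}(T) = End_Hdg(T)`" (Huybrechts p. 66; Zarhin §2).

Named facts: none. Everything stated is proved.

## References

* D. Huybrechts, *Lectures on K3 Surfaces* (CUP 2016), §3.3.4 (p. 66), Thm. 3.3.9.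
* Yu. G. Zarhin, *Hodge groups of K3 surfaces*, J. reine angew. Math. 341 (1983), §2.
* A. Borel, *Linear Algebraic Groups*, 2nd ed. (1991), §3.8–3.9, §7.
* P. Deligne, *Hodge cycles on abelian varieties*, LNM 900 (1982), I §3.
-/

noncomputable section

open scoped TensorProduct PiTensorProduct

namespace Literature.AlgebraicGeometry.Motives

namespace HodgeStructure

universe u

variable {V : Type u} [AddCommGroup V] [Module ℚ V] [Module.Finite ℚ V] [HodgeTensorFacts.{u, u}]
  {n : ℤ}

/-! ### The Lie algebra of the Hodge group over `ℚ` -/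

/-- An index for the Hodge tensors of `H` of all types `(p,p)`: a bidegree `(a, b)`, a level `p`
with `(a - b) n = 2p`, and a Hodge class `t ∈ Hdg^{p,p}(T^{a,b})` (these are exactly the tensors
the tree's `hodgeGroup` must fix, `mem_hodgeGroup_iff`). [folklore] -/
structure HodgeTensorIdxPP (H : HodgeStructure V n) where
  /-- number of covariant factors -/
  a : ℕ
  /-- number of contravariant factors -/
  b : ℕ
  /-- the Hodge level -/
  p : ℤ
  /-- the weight `(a - b) n` of `T^{a,b}` is `2p` -/
  hab : ((a : ℤ) - b) * n = 2 * p
  /-- the Hodge tensor -/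
  t : hodgeTensorSpace V a b
  /-- `t` is a Hodge class of type `(p,p)` -/
  ht : t ∈ (H.tensorSpace a b).hodgeClasses p

/-- **The Lie algebra `𝔥 = Lie(Hdg)` of the Hodge group** (over `ℚ`): the endomorphisms `X` of
`V` whose derivation action kills every Hodge tensor of every type `(p,p)` — the Lie algebra of
the stabiliser of the Hodge tensors, whose group of rational points is `H.hodgeGroup` (Borel,
*Linear Algebraic Groups*, §3.8–3.9 and §7; Huybrechts §3.3.4; Deligne, LNM 900, I 3.4).
[folklore] -/
def hodgeLie (H : HodgeStructure V n) : Submodule ℚ (Module.End ℚ V) :=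
  ⨅ α : H.HodgeTensorIdxPP, LinearMap.ker (derivationAt α.t)

/-- Membership in `𝔥`: `ρ(X)` kills every Hodge tensor of every type `(p,p)`. [folklore] -/
theorem mem_hodgeLie_iff (H : HodgeStructure V n) (X : Module.End ℚ V) :
    X ∈ H.hodgeLie ↔ ∀ (a b : ℕ) (p : ℤ), ((a : ℤ) - b) * n = 2 * p →
      ∀ t ∈ (H.tensorSpace a b).hodgeClasses p, tensorDerivation a b X t = 0 := by
  simp only [hodgeLie, Submodule.mem_iInf, LinearMap.mem_ker, derivationAt_apply]
  exact ⟨fun h a b p hab t ht => h ⟨a, b, p, hab, t, ht⟩, fun h α => h α.a α.b α.p α.hab α.t α.ht⟩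

/-- `Lie(Hdg) ⊆ Lie(MT-stabiliser)`: killing all Hodge tensors of type `(p,p)` in particular
kills those of weight `0` and type `(0,0)` (`hodgeGroup_le_mumfordTateGroup`, infinitesimally).
[folklore] -/
theorem hodgeLie_le_lieStabilizer (H : HodgeStructure V n) : H.hodgeLie ≤ H.lieStabilizer := by
  intro X hX
  rw [mem_lieStabilizer_iff]
  intro a b hab t ht
  exact (H.mem_hodgeLie_iff X).1 hX a b 0 (by simpa using hab) t ht

/-- **`𝔥` is a Lie subalgebra of `𝔤𝔩(V)`**: `XY - YX ∈ 𝔥` for `X, Y ∈ 𝔥` (the derivation action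
is a Lie algebra homomorphism, `tensorDerivation_commutator`). [folklore] -/
theorem commutator_mem_hodgeLie (H : HodgeStructure V n) {X Y : Module.End ℚ V}
    (hX : X ∈ H.hodgeLie) (hY : Y ∈ H.hodgeLie) : X * Y - Y * X ∈ H.hodgeLie := by
  rw [mem_hodgeLie_iff] at hX hY ⊢
  intro a b p hab t ht
  exact tensorDerivation_commutator_apply_eq_zero (hX a b p hab t ht) (hY a b p hab t ht)

/-! ### The complexified Lie algebra -/

/-- **The complexified Lie algebra `𝔥_ℂ ⊆ End_ℂ(V_ℂ)`**: the `ℂ`-span of the complexifications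
`X_ℂ` of the elements of `𝔥` (`= Lie(Hdg) ⊗ ℂ`, since `X ↦ X_ℂ` is injective and `ℂ`-linearly
independent on a `ℚ`-basis; equal to the complex annihilator by `mem_hodgeLieC_iff`). [folklore] -/
def hodgeLieC (H : HodgeStructure V n) : Submodule ℂ (Module.End ℂ (ℂ ⊗[ℚ] V)) :=
  Submodule.span ℂ ((fun X : Module.End ℚ V => X.baseChange ℂ) '' (H.hodgeLie : Set _))

/-- `X_ℂ ∈ 𝔥_ℂ` for `X ∈ 𝔥`. [folklore] -/
theorem baseChange_mem_hodgeLieC (H : HodgeStructure V n) {X : Module.End ℚ V}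
    (hX : X ∈ H.hodgeLie) : X.baseChange ℂ ∈ H.hodgeLieC :=
  Submodule.subset_span ⟨X, hX, rfl⟩

omit [HodgeTensorFacts.{u, u}] in
/-- Naturality: `ρ(X_ℂ) (ι t) = ι (ρ(X) t)`. [folklore] -/
theorem tensorDerivation_baseChange_tensorSpaceToBaseChange {a b : ℕ} (X : Module.End ℚ V)
    (t : hodgeTensorSpace V a b) :
    tensorDerivation a b (X.baseChange ℂ) (tensorSpaceToBaseChange ℂ V a b t) =
      tensorSpaceToBaseChange ℂ V a b (tensorDerivation a b X t) := by
  rw [← hodgeTensorSpaceBaseChange_one_tmul, ← hodgeTensorSpaceBaseChange_one_tmul,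
    ← hodgeTensorSpaceBaseChange_tensorDerivation, LinearMap.baseChange_tmul]

/-- **`𝔥_ℂ` is the complex annihilator of the complexified Hodge tensors** ("`Hdg` is defined
over `ℚ`"): `Y ∈ 𝔥_ℂ` iff `ρ(Y)` kills `ι t` for every Hodge tensor `t` of every type `(p,p)`.
The implication `←` is the descent statement `mem_span_baseChange_of_forall_tensorDerivation_eq_zero`.
[folklore] -/
theorem mem_hodgeLieC_iff (H : HodgeStructure V n) (Y : Module.End ℂ (ℂ ⊗[ℚ] V)) :
    Y ∈ H.hodgeLieC ↔ ∀ (a b : ℕ) (p : ℤ), ((a : ℤ) - b) * n = 2 * p →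
      ∀ t ∈ (H.tensorSpace a b).hodgeClasses p,
        tensorDerivation a b Y (tensorSpaceToBaseChange ℂ V a b t) = 0 := by
  constructor
  · intro hY a b p hab t ht
    induction hY using Submodule.span_induction with
    | mem Z hZ =>
      obtain ⟨X, hX, rfl⟩ := hZ
      rw [tensorDerivation_baseChange_tensorSpaceToBaseChange,
        (H.mem_hodgeLie_iff X).1 hX a b p hab t ht, map_zero]
    | zero => simp
    | add Z Z' _ _ hZ hZ' => rw [map_add, LinearMap.add_apply, hZ, hZ', add_zero]
    | smul c Z _ hZ => rw [map_smul, LinearMap.smul_apply, hZ, smul_zero]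
  · intro hY
    have h := mem_span_baseChange_of_forall_tensorDerivation_eq_zero
      (fun a b => {t : hodgeTensorSpace V a b |
        ∃ p : ℤ, ((a : ℤ) - b) * n = 2 * p ∧ t ∈ (H.tensorSpace a b).hodgeClasses p})
      (fun a b t ⟨p, hab, ht⟩ => hY a b p hab t ht)
    refine Submodule.span_mono ?_ h
    rintro _ ⟨X, hX, rfl⟩
    refine ⟨X, (H.mem_hodgeLie_iff X).2 fun a b p hab t ht => hX a b t ⟨p, hab, ht⟩, rfl⟩

/-- **`𝔥_ℂ` is a Lie subalgebra of `𝔤𝔩(V_ℂ)`.** [folklore] -/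
theorem commutator_mem_hodgeLieC (H : HodgeStructure V n) {Y Z : Module.End ℂ (ℂ ⊗[ℚ] V)}
    (hY : Y ∈ H.hodgeLieC) (hZ : Z ∈ H.hodgeLieC) : Y * Z - Z * Y ∈ H.hodgeLieC := by
  rw [mem_hodgeLieC_iff] at hY hZ ⊢
  intro a b p hab t ht
  exact tensorDerivation_commutator_apply_eq_zero (hY a b p hab t ht) (hZ a b p hab t ht)

/-- **The infinitesimal Hodge operator lies in `𝔥_ℂ`**: any `Θ` acting on `V^{p,n-p}` by
`2p - n = p - q` (`exists_hodgeTheta`) kills the complexified Hodge tensors, hence `Θ ∈ 𝔥_ℂ` —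
the infinitesimal form of "`ρ(𝕌(ℝ)) ⊂ Hdg(V)(ℝ)`" (Huybrechts §3.3.4, p. 66; Deligne I 3.4), made
available inside the `ℚ`-structure by descent. [cite: Huybrechts2016K3, §3.3.4 (p. 66)] -/
theorem mem_hodgeLieC_of_forall_piece (H : HodgeStructure V n) {Θ : Module.End ℂ (ℂ ⊗[ℚ] V)}
    (hΘ : ∀ p, ∀ x ∈ H.piece p (n - p), Θ x = ((2 * p - n : ℤ) : ℂ) • x) : Θ ∈ H.hodgeLieC := by
  rw [mem_hodgeLieC_iff]
  intro a b p hab t ht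
  exact tensorDerivation_hodgeTheta_apply_eq_zero H hΘ hab ht

/-- **`𝔥_ℂ` is `Ad`-stable under every automorphism of `V_ℂ` fixing the complexified Hodge
tensors** (e.g. the Weil operator, or `h(z)`, `z ∈ U(1)`): `k Y k⁻¹ ∈ 𝔥_ℂ` for `Y ∈ 𝔥_ℂ`
(`Ad`-equivariance of the derivation action). [folklore] -/
theorem conj_mem_hodgeLieC (H : HodgeStructure V n) {k : (ℂ ⊗[ℚ] V) ≃ₗ[ℂ] (ℂ ⊗[ℚ] V)}
    (hk : ∀ (a b : ℕ) (p : ℤ), ((a : ℤ) - b) * n = 2 * p →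
      ∀ t ∈ (H.tensorSpace a b).hodgeClasses p,
        tensorSpaceActOver k (tensorSpaceToBaseChange ℂ V a b t) = tensorSpaceToBaseChange ℂ V a b t)
    {Y : Module.End ℂ (ℂ ⊗[ℚ] V)} (hY : Y ∈ H.hodgeLieC) :
    (k : ℂ ⊗[ℚ] V →ₗ[ℂ] ℂ ⊗[ℚ] V) ∘ₗ Y ∘ₗ (k.symm : ℂ ⊗[ℚ] V →ₗ[ℂ] ℂ ⊗[ℚ] V) ∈ H.hodgeLieC := by
  rw [mem_hodgeLieC_iff] at hY ⊢
  intro a b p hab t ht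
  exact tensorDerivation_conj_apply_eq_zero k (hk a b p hab t ht) (hY a b p hab t ht)

/-- **`𝔥_ℂ` is stable under `Ad` of the Weil operator**: for any `C` acting on `V^{p,n-p}` by
`i^{2p-n}` (`exists_weilOperator`), `C Y C⁻¹ ∈ 𝔥_ℂ` for `Y ∈ 𝔥_ℂ`. [folklore] -/
theorem conj_mem_hodgeLieC_of_forall_piece (H : HodgeStructure V n)
    {C : (ℂ ⊗[ℚ] V) ≃ₗ[ℂ] (ℂ ⊗[ℚ] V)}
    (hC : ∀ p, ∀ x ∈ H.piece p (n - p), C x = (Complex.I ^ (2 * p - n)) • x)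
    {Y : Module.End ℂ (ℂ ⊗[ℚ] V)} (hY : Y ∈ H.hodgeLieC) :
    (C : ℂ ⊗[ℚ] V →ₗ[ℂ] ℂ ⊗[ℚ] V) ∘ₗ Y ∘ₗ (C.symm : ℂ ⊗[ℚ] V →ₗ[ℂ] ℂ ⊗[ℚ] V) ∈ H.hodgeLieC :=
  H.conj_mem_hodgeLieC (fun _ _ _ hab _ ht => tensorSpaceActOver_weilOperator_eq_self H hC hab ht) hY

/-! ### `𝔥 ⊆ so(ψ)` and `𝔥` commutes with `End_Hdg(V)` -/

/-- **`𝔥 ⊆ so(V, ψ)`: every `X ∈ Lie(Hdg)` is skew for every polarization `ψ`** —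
`ψ(Xv, w) + ψ(v, Xw) = 0` (infinitesimal form of `Hdg ⊂ SO(T, ψ)`, Huybrechts Thm. 3.3.9 /
proof p. 67: `ψ` is a Hodge tensor in `T^{0,2}`, `sum_sum_smul_tprod_tmul_tprod_mem_hodgeClasses`;
differentiate `ψ(gv, gw) = ψ(v, w)`). [cite: Huybrechts2016K3, Thm. 3.3.9 (proof, p. 67)] -/
theorem form_apply_add_eq_zero_of_mem_hodgeLie {H : HodgeStructure V n} (ψ : H.Polarization)
    {X : Module.End ℚ V} (hX : X ∈ H.hodgeLie) (v w : V) :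
    ψ.form (X v) w + ψ.form v (X w) = 0 := by
  classical
  set b := Module.finBasis ℚ V with hb
  obtain ⟨t, ht⟩ : ∃ t : hodgeTensorSpace V 0 2, t =
      ∑ i, ∑ j, ψ.form (b i) (b j) • (PiTensorProduct.tprod ℚ (Fin.elim0 : Fin 0 → V) ⊗ₜ[ℚ]
        PiTensorProduct.tprod ℚ ![b.coord i, b.coord j]) := ⟨_, rfl⟩
  have hmem : t ∈ (H.tensorSpace 0 2).hodgeClasses (-n) :=
    ht ▸ sum_sum_smul_tprod_tmul_tprod_mem_hodgeClasses ψ b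
  have hkill : tensorDerivation 0 2 X t = 0 :=
    (H.mem_hodgeLie_iff X).1 hX 0 2 (-n) (by ring) t hmem
  -- evaluate against the functional `⊗() ⊗ ⊗(φ₀, φ₁) ↦ φ₀(v) φ₁(w)`
  obtain ⟨μ, hμ⟩ : ∃ μ : hodgeTensorSpace V 0 2 →ₗ[ℚ] ℚ, μ =
    LinearMap.mul' ℚ ℚ ∘ₗ TensorProduct.map
      (PiTensorProduct.isEmptyEquiv (Fin 0) : (⨂[ℚ] _ : Fin 0, V) ≃ₗ[ℚ] ℚ).toLinearMap
      (PiTensorProduct.lift ((MultilinearMap.mkPiAlgebra ℚ (Fin 2) ℚ).compLinearMap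
        fun m => Module.Dual.eval ℚ V ((![v, w] : Fin 2 → V) m))) := ⟨_, rfl⟩
  have hμapply : ∀ (x : Fin 0 → V) (φ : Fin 2 → Module.Dual ℚ V),
      μ (PiTensorProduct.tprod ℚ x ⊗ₜ[ℚ] PiTensorProduct.tprod ℚ φ) = φ 0 v * φ 1 w := by
    intro x φ
    simp [hμ, MultilinearMap.mkPiAlgebra_apply, Module.Dual.eval_apply, Fin.prod_univ_two]
  have hD : ∀ i j : Fin (Module.finrank ℚ V), tensorDerivation 0 2 X
      (PiTensorProduct.tprod ℚ (Fin.elim0 : Fin 0 → V) ⊗ₜ[ℚ]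
        PiTensorProduct.tprod ℚ ![b.coord i, b.coord j]) =
      -(PiTensorProduct.tprod ℚ (Fin.elim0 : Fin 0 → V) ⊗ₜ[ℚ]
          (PiTensorProduct.tprod ℚ ![(b.coord i).comp X, b.coord j] +
           PiTensorProduct.tprod ℚ ![b.coord i, (b.coord j).comp X])) := by
    intro i j
    have h0 : Function.update (![b.coord i, b.coord j] : Fin 2 → Module.Dual ℚ V) 0
        (((![b.coord i, b.coord j] : Fin 2 → Module.Dual ℚ V) 0).comp X) =
        ![(b.coord i).comp X, b.coord j] := by
      funext m; fin_cases m <;> rfl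
    have h1 : Function.update (![b.coord i, b.coord j] : Fin 2 → Module.Dual ℚ V) 1
        (((![b.coord i, b.coord j] : Fin 2 → Module.Dual ℚ V) 1).comp X) =
        ![b.coord i, (b.coord j).comp X] := by
      funext m; fin_cases m <;> rfl
    rw [tensorDerivation_tmul_tprod, Fin.sum_univ_zero, TensorProduct.zero_tmul, zero_sub,
      Fin.sum_univ_two, h0, h1]
  have h := congrArg μ hkill
  rw [ht, map_sum, map_sum, map_zero] at h
  simp_rw [map_sum, map_smul, hD, map_neg, TensorProduct.tmul_add, map_add, hμapply] at h
  simp only [Matrix.cons_val_zero, Matrix.cons_val_one, LinearMap.comp_apply,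
    Module.Basis.coord_apply, smul_eq_mul] at h
  have key : ∀ i j : Fin (Module.finrank ℚ V),
      ψ.form (b i) (b j) * -(b.repr (X v) i * b.repr w j + b.repr v i * b.repr (X w) j) =
        -(b.repr (X v) i * b.repr w j * ψ.form (b i) (b j) +
          b.repr v i * b.repr (X w) j * ψ.form (b i) (b j)) := fun i j => by ring
  simp_rw [key, Finset.sum_neg_distrib, neg_eq_zero, Finset.sum_add_distrib] at h
  rw [bilin_apply_apply_eq_sum_sum_repr b ψ.form (X v) w,
    bilin_apply_apply_eq_sum_sum_repr b ψ.form v (X w)]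
  exact h

/-- **`𝔥` commutes with `End_Hdg(V)`**: `X a = a X` for `X ∈ Lie(Hdg)` and every Hodge
endomorphism `a` (infinitesimal form of `Hdg ⊂ GL_K(T)`, Huybrechts Thm. 3.3.9, proof p. 67:
`a ∈ T^{1,1}` is a Hodge tensor, `sum_tprod_tmul_tprod_coord_mem_hodgeClasses`).
[cite: Huybrechts2016K3, Thm. 3.3.9 (proof, p. 67)] -/
theorem commute_of_mem_hodgeLie (H : HodgeStructure V n) {X : Module.End ℚ V} (hX : X ∈ H.hodgeLie)
    (a : H.endAlg) : X * (a : Module.End ℚ V) = (a : Module.End ℚ V) * X := by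
  classical
  set b := Module.finBasis ℚ V with hb
  obtain ⟨t, ht⟩ : ∃ t : hodgeTensorSpace V 1 1, t =
      ∑ i, PiTensorProduct.tprod ℚ (fun _ : Fin 1 => (a : Module.End ℚ V) (b i)) ⊗ₜ[ℚ]
        PiTensorProduct.tprod ℚ (fun _ : Fin 1 => b.coord i) := ⟨_, rfl⟩
  have hmem : t ∈ (H.tensorSpace 1 1).hodgeClasses 0 :=
    ht ▸ sum_tprod_tmul_tprod_coord_mem_hodgeClasses H a b
  have hkill : tensorDerivation 1 1 X t = 0 :=
    (H.mem_hodgeLie_iff X).1 hX 1 1 0 (by simp) t hmem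
  have key : ∀ (f : Module.Dual ℚ V) (v : V),
      f (X ((a : Module.End ℚ V) v)) - f ((a : Module.End ℚ V) (X v)) = 0 := by
    intro f v
    obtain ⟨μ, hμ⟩ : ∃ μ : hodgeTensorSpace V 1 1 →ₗ[ℚ] ℚ, μ =
      LinearMap.mul' ℚ ℚ ∘ₗ TensorProduct.map
        (PiTensorProduct.lift ((MultilinearMap.mkPiAlgebra ℚ (Fin 1) ℚ).compLinearMap fun _ => f))
        (PiTensorProduct.lift ((MultilinearMap.mkPiAlgebra ℚ (Fin 1) ℚ).compLinearMap
          fun _ => Module.Dual.eval ℚ V v)) := ⟨_, rfl⟩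
    have hμapply : ∀ (x : Fin 1 → V) (φ : Fin 1 → Module.Dual ℚ V),
        μ (PiTensorProduct.tprod ℚ x ⊗ₜ[ℚ] PiTensorProduct.tprod ℚ φ) = f (x 0) * φ 0 v := by
      intro x φ
      simp [hμ, MultilinearMap.mkPiAlgebra_apply, Module.Dual.eval_apply]
    have hD : ∀ i : Fin (Module.finrank ℚ V), tensorDerivation 1 1 X
        (PiTensorProduct.tprod ℚ (fun _ : Fin 1 => (a : Module.End ℚ V) (b i)) ⊗ₜ[ℚ]
          PiTensorProduct.tprod ℚ (fun _ : Fin 1 => b.coord i)) =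
        PiTensorProduct.tprod ℚ (fun _ : Fin 1 => X ((a : Module.End ℚ V) (b i))) ⊗ₜ[ℚ]
            PiTensorProduct.tprod ℚ (fun _ : Fin 1 => b.coord i) -
          PiTensorProduct.tprod ℚ (fun _ : Fin 1 => (a : Module.End ℚ V) (b i)) ⊗ₜ[ℚ]
            PiTensorProduct.tprod ℚ (fun _ : Fin 1 => (b.coord i).comp X) := by
      intro i
      rw [tensorDerivation_tmul_tprod, Fin.sum_univ_one, Fin.sum_univ_one]
      congr 3
      · funext m; simp [Fin.fin_one_eq_zero m]
      · funext m; simp [Fin.fin_one_eq_zero m]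
    have h := congrArg μ hkill
    rw [ht, map_sum, map_sum, map_zero] at h
    simp_rw [hD, map_sub, hμapply, LinearMap.comp_apply, Module.Basis.coord_apply] at h
    rw [Finset.sum_sub_distrib] at h
    have e1 := apply_apply_eq_sum_repr b f (X * (a : Module.End ℚ V)) v
    simp only [Module.End.mul_apply] at e1
    rw [e1, apply_apply_eq_sum_repr b f (a : Module.End ℚ V) (X v)]
    exact h
  apply LinearMap.ext fun v => ?_
  rw [← sub_eq_zero, ← Module.forall_dual_apply_eq_zero_iff ℚ]
  intro f
  rw [map_sub]
  exact key f v

/-- Complex form of skewness: every `Y ∈ 𝔥_ℂ` is skew for `ψ_ℂ`,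
`ψ_ℂ(Y x, y) = -ψ_ℂ(x, Y y)`. [folklore] -/
theorem formBaseChange_skew_of_mem_hodgeLieC {H : HodgeStructure V n} (ψ : H.Polarization)
    {Y : Module.End ℂ (ℂ ⊗[ℚ] V)} (hY : Y ∈ H.hodgeLieC) (x y : ℂ ⊗[ℚ] V) :
    ψ.form.baseChange ℂ (Y x) y = -ψ.form.baseChange ℂ x (Y y) := by
  induction hY using Submodule.span_induction generalizing x y with
  | mem Z hZ =>
    obtain ⟨X, hX, rfl⟩ := hZ
    -- reduce to pure tensors
    have key : ∀ x y : ℂ ⊗[ℚ] V, ψ.form.baseChange ℂ (X.baseChange ℂ x) y +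
        ψ.form.baseChange ℂ x (X.baseChange ℂ y) = 0 := by
      intro x y
      induction x using TensorProduct.induction_on with
      | zero => simp
      | tmul c v =>
        induction y using TensorProduct.induction_on with
        | zero => simp
        | tmul d w =>
          simp only [LinearMap.baseChange_tmul, LinearMap.BilinForm.baseChange_tmul]
          rw [← add_smul, form_apply_add_eq_zero_of_mem_hodgeLie ψ hX v w, zero_smul]
        | add y y' hy hy' => rw [map_add, map_add, map_add, add_add_add_comm, hy, hy', add_zero]
      | add x x' hx hx' =>
        rw [map_add, map_add, LinearMap.add_apply, map_add, LinearMap.add_apply,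
          add_add_add_comm, hx, hx', add_zero]
    exact eq_neg_of_add_eq_zero_left (key x y)
  | zero => simp
  | add Z Z' _ _ hZ hZ' =>
    rw [LinearMap.add_apply, LinearMap.add_apply, map_add, LinearMap.add_apply, map_add, hZ, hZ',
      neg_add]
  | smul c Z _ hZ =>
    rw [LinearMap.smul_apply, LinearMap.smul_apply, map_smul, LinearMap.smul_apply, map_smul,
      hZ, smul_neg]

/-- Complex form of `E`-linearity: every `Y ∈ 𝔥_ℂ` commutes with `a_ℂ`, `a ∈ End_Hdg(V)`.
[folklore] -/
theorem commute_baseChange_of_mem_hodgeLieC (H : HodgeStructure V n)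
    {Y : Module.End ℂ (ℂ ⊗[ℚ] V)} (hY : Y ∈ H.hodgeLieC) (a : H.endAlg) :
    Y * (a : Module.End ℚ V).baseChange ℂ = (a : Module.End ℚ V).baseChange ℂ * Y := by
  induction hY using Submodule.span_induction with
  | mem Z hZ =>
    obtain ⟨X, hX, rfl⟩ := hZ
    have h := congrArg (LinearMap.baseChange ℂ) (H.commute_of_mem_hodgeLie hX a)
    rw [LinearMap.baseChange_mul, LinearMap.baseChange_mul] at h
    exact h
  | zero => simp
  | add Z Z' _ _ hZ hZ' => rw [add_mul, mul_add, hZ, hZ']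
  | smul c Z _ hZ => rw [smul_mul_assoc, mul_smul_comm, hZ]

/-! ### The commutant of `𝔥` is `End_Hdg(V)` -/

/-- **A rational endomorphism commuting with `Lie(Hdg)` is a Hodge endomorphism.** Proof: its
complexification commutes with `𝔥_ℂ ∋ Θ`, hence preserves the eigenspaces of `Θ`, which are the
Hodge pieces `V^{p,n-p}` (eigenvalue `2p - n`, pairwise distinct), hence the filtration
`F^p = ⊕_{p' ≥ p} V^{p',n-p'}`. This is the tree's form of `End_{Hdg}(V) = End_Hdg(V)`
(Huybrechts p. 66: "the Hodge classes of `End(V)` are the Hodge endomorphisms").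
[cite: Huybrechts2016K3, §3.3.4 (p. 66)] -/
theorem mem_endAlg_of_forall_commute (H : HodgeStructure V n) {c : Module.End ℚ V}
    (hc : ∀ X ∈ H.hodgeLie, c * X = X * c) : c ∈ H.endAlg := by
  classical
  obtain ⟨Θ, hΘ⟩ := exists_hodgeTheta H
  -- `c_ℂ` commutes with `Θ ∈ 𝔥_ℂ`
  have hcomm : ∀ Y ∈ H.hodgeLieC, c.baseChange ℂ * Y = Y * c.baseChange ℂ := by
    intro Y hY
    induction hY using Submodule.span_induction with
    | mem Z hZ =>
      obtain ⟨X, hX, rfl⟩ := hZ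
      have h := congrArg (LinearMap.baseChange ℂ) (hc X hX)
      rw [LinearMap.baseChange_mul, LinearMap.baseChange_mul] at h
      exact h
    | zero => simp
    | add Z Z' _ _ hZ hZ' => rw [add_mul, mul_add, hZ, hZ']
    | smul a Z _ hZ => rw [smul_mul_assoc, mul_smul_comm, hZ]
  have hcΘ := hcomm Θ (H.mem_hodgeLieC_of_forall_piece hΘ)
  -- the pieces are the eigenspaces of `Θ`, so `c_ℂ` preserves them
  obtain ⟨S, deg, e, hF, hFc⟩ := exists_basis_F_eq_span H
  haveI : Fintype S := FiniteDimensional.fintypeBasisIndex e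
  have hΘe : ∀ σ, Θ (e σ) = (fun d : ℤ => ((2 * d - n : ℤ) : ℂ)) (deg σ) • e σ :=
    apply_basis_eq_of_forall_piece H e hF hFc (f := fun d : ℤ => ((2 * d - n : ℤ) : ℂ)) hΘ
  have hpiece : ∀ p, H.piece p (n - p) = Module.End.eigenspace Θ ((2 * p - n : ℤ) : ℂ) := by
    intro p
    rw [piece_eq_span_of_graded H e hF hFc, eigenspace_eq_span_of_diag e hΘe]
    congr 2
    ext σ
    simp only [Set.mem_setOf_eq, Int.cast_inj]
    omega
  have hpres : ∀ p, ∀ x ∈ H.piece p (n - p), c.baseChange ℂ x ∈ H.piece p (n - p) := by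
    intro p x hx
    rw [hpiece] at hx ⊢
    rw [Module.End.mem_eigenspace_iff] at hx ⊢
    rw [← Module.End.mul_apply, ← hcΘ, Module.End.mul_apply, hx, map_smul]
  rw [mem_endAlg_iff]
  intro p
  rw [Submodule.map_le_iff_le_comap, F_eq_iSup_piece_holds H p]
  refine iSup₂_le fun i hi x hx => ?_
  exact Submodule.mem_iSup_of_mem i (Submodule.mem_iSup_of_mem hi (hpres i x hx))

/-- **The commutant of `𝔥_ℂ` is `End_Hdg(V) ⊗ ℂ`**: a `ℂ`-linear endomorphism of `V_ℂ` commuting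
with all `X_ℂ`, `X ∈ Lie(Hdg)`, lies in `span_ℂ {a_ℂ | a ∈ End_Hdg(V)}` (commutant descent
`mem_span_baseChange_of_forall_commute` + `mem_endAlg_of_forall_commute`). In Zarhin's theorem
this says that `𝔥_ℂ` acts on each eigenspace `T_σ` of `E = End_Hdg(T)` with scalar commutant
(Zarhin 1983, §2; Huybrechts Thm. 3.3.9). [cite: Zarhin1983HodgeGroupsK3, §2] -/
theorem mem_span_endAlg_of_forall_commute (H : HodgeStructure V n)
    {Y : Module.End ℂ (ℂ ⊗[ℚ] V)} (hY : ∀ X ∈ H.hodgeLie, Y * X.baseChange ℂ = X.baseChange ℂ * Y) :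
    Y ∈ Submodule.span ℂ ((fun a : Module.End ℚ V => a.baseChange ℂ) '' (H.endAlg : Set _)) := by
  have h := mem_span_baseChange_of_forall_commute (H.hodgeLie : Set (Module.End ℚ V)) hY
  refine Submodule.span_mono ?_ h
  rintro _ ⟨c, hc, rfl⟩
  exact ⟨c, H.mem_endAlg_of_forall_commute hc, rfl⟩

end HodgeStructure

end Literature.AlgebraicGeometry.Motives

end
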